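import Summits.BirchSwinnertonDyer.BirchSwinnertonDyer.Theorems.RamifiedHeegnerPairLeafRankZeroUpperAtThreePartnerLowerTwoSplit
import Summits.BirchSwinnertonDyer.BirchSwinnertonDyer.Theorems.RamifiedHeegnerPairLeafRankZeroUpperAtThreeMonoCarrierAny
import HarnessLib

/-!
# Route `RamifiedHeegnerPair`, residual crux U₀ `LeafRankZeroUpperAtThree` (stmt-BirchSwinnertonDyer-26024), line `splitkolyvagin0` —
# the PARTNER-LOWER and TWIST-UNIT roads over the ANY-CARRIER reading: U₀ ⟸ PUB₀⁺ ∧ three named facts ∧ Σ★‴ ∧ PL₁|₂ (tight), and the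
# per-curve CERTIFICATE SHAPE on a mono-carrier row of ANY reduction type: U₀ at `W` ⟸ print ∧ F1–F3 ∧ ONE rank-zero twist-unit certificate

HONEST FRAMING. Theorems only; helper file (`--supports stmt-BirchSwinnertonDyer-26024 --as helper`); nothing is booked, no item is
closed, BSD is not proved for any curve; CONDITIONAL on every displayed input. Lead prover bsd-line-rhp-p2 g9, 2026-08-28. = p641367
(`…LeafRankZeroUpperAtThreePartnerLowerTwoSplit`) re-run with S2|₂ ↦ the ANY-CARRIER reading R|₂ (`JetchevReadingAnyCarrier.anyCarrierTwoSplitReading_of_namedFacts`,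
p643642; through `sigmaAtDatum_three_of_anyCarrierReading_monoCarrierAny`, p645085) and Σ★″ (27493) ↦ the weaker Σ★‴ (off the mono-carrier
rows of any reduction type). Rank-zero mirror of `…LeafRankOneUpperAtThreePartnerTwistAny`.

* §1₀ `leafRankZeroUpper_three_monoCarrierAny_of_anyCarrierReading_of_partnerLowerZeroTwoSplit` — U₀ at `W` on ONE mono-carrier row (any type)
  with a `3 ∤ c` datum ⟸ print + R|₂ + PL₁|₂(W).
* §2₀/§3₀ lattice-optimal member and the class statement BY NAME: **`LeafRankZeroUpperAtThree` ⟸ PUB₀⁺ ∧ F1 ∧ F2 ∧ F3 ∧ Σ★‴ ∧ PL₁|₂`** —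
  NEITHER L₁ NOR L₀; PL₁|₂ ⟸ L₁ / ⟸ TU₀|₂ / ⟸ the leaf (tight) are p641367 §5, unchanged.
* §4₀ **`leafRankZeroUpper_three_monoCarrierAny_of_namedFacts_of_twistUnitZeroTwoSplit`** — the per-curve CERTIFICATE SHAPE: U₀ AT ONE CURVE on
  a mono-carrier row of ANY reduction type ⟸ printed facts ∧ {F1, F2, F3} ∧ TU₀|₂(W) — no S2, no L-member, no Σ. Serves the 43 rank-zero
  Gss2 classes with ONE additive Tamagawa-`3` carrier exactly as p641367's shape serves the 190 mono-multiplicative ones.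

NET (mod print ∪ {F1, F2, F3}): **U₀ ⟸ Σ★‴ ∧ ((L₁ ∧ L₀) | PL₁|₂)**, PL₁|₂ ⟸ L₁ | TU₀|₂ | leaf.
References: [cite: Jetchev2008, Thm. 1.4 (ii), Cor. 1.5, Conj. 1.3 (p. 812)] [cite: GrossLMS1991, Prop. 3.7 (2) (p. 240), §6 p. 245]
[cite: MilneADT2006, Ch. I, Thm. 4.10(b); Thm. I.7.3 and Remark I.7.4] [cite: GrossZagier1986, III (3.1); Thm. I.(6.3)]
[cite: MatarNekovar2019, Thm. 0.7 and Thm. 0.3 (p. 456)] [cite: CastellaGrossiLeeSkinner2022, proof of Thm. 5.3.1, display (5.6)]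
[cite: BumpFriedbergHoffstein1990, Theorem (pp. 543–544)] [cite: Mazur1978, Cor. 4.1] [cite: Miller2011LMS, §1 and Def. 1.1].
-/

-- D-0017: single-problem summit, so `Summit.BirchSwinnertonDyer.BirchSwinnertonDyer.…` repeats a namespace BY DESIGN.
set_option linter.dupNamespace false
set_option autoImplicit false

noncomputable section

open scoped Classical NumberField

open WeierstrassCurve IsDedekindDomain IsDedekindDomain.HeightOneSpectrum NumberField
  Rat.HeightOneSpectrum Literature Literature.NumberTheory.EllipticCurves
  Literature.NumberTheory.EllipticCurves.ModularForms
  Literature.NumberTheory.EllipticCurves.Rank1Residual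
  Literature.NumberTheory.EllipticCurves.Rank1Residual.Typed
  Literature.NumberTheory.EllipticCurves.KrizLi2019
  Literature.NumberTheory.QuadraticFields
  Summit.BirchSwinnertonDyer.Rank1Residual
  Summit.BirchSwinnertonDyer.Rank1Residual.Additive
  Summit.BirchSwinnertonDyer.Rank1Residual.X11b.Three
  Summit.BirchSwinnertonDyer.BirchSwinnertonDyer.Theses.RamifiedHeegnerPair
  Summit.BirchSwinnertonDyer.BirchSwinnertonDyer.Theorems
  Summit.BirchSwinnertonDyer.BirchSwinnertonDyer.Theorems.SchneiderFree
  Summit.BirchSwinnertonDyer.BirchSwinnertonDyer.Theorems.JetchevReadingAnyCarrier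

namespace Summit.BirchSwinnertonDyer.BirchSwinnertonDyer.Theorems.RamifiedPairUpperBound

/-! ## §1₀ The mono-carrier rank-zero rows of ANY reduction type: U₀ ⟸ print + R|₂ + PL₁|₂(W) -/

/-- **U₀ AT A RANK-ZERO LEAF CURVE ON A MONO-CARRIER ROW (carrier of ANY reduction type) WITH A MANIN-CLEAN DATUM, from R|₂ and PL₁|₂(W).**
p641367 §1 with Σ₀ at `Dt` from `sigmaAtDatum_three_of_anyCarrierReading_monoCarrierAny` (p645085): the carrier is any prime `q ∣ N_E` with
`ord₃ ∏ c_ℓ(W) ≤ ord₃ c_q(W)`; no `q ∥ N`, no «carriers multiplicative». CONDITIONAL; nothing asserted.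
[cite: Jetchev2008, Thm. 1.4 and Cor. 1.5 (p. 812)] [cite: MatarNekovar2019, Thm. 0.7 (p. 456)] [cite: Miller2011LMS, Def. 1.1] -/
theorem leafRankZeroUpper_three_monoCarrierAny_of_anyCarrierReading_of_partnerLowerZeroTwoSplit
    (hGZ : ∀ (N : ℕ) [NeZero N] (W : WeierstrassCurve ℚ) (K : Type) [Field K] [NumberField K],
      gross_zagier N W K)
    (hKo : ∀ (N : ℕ) [NeZero N] (W : WeierstrassCurve ℚ) (K : Type) [Field K] [NumberField K],
      kolyvagin N W K)
    (hGZK : rank_eq_analyticRank_of_analyticRank_le_one) (hmod : hasEntireLFunction_rat)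
    (hMN : MatarNekovar2019.thm07_padicValNat_card_sha_primary_add_le_of_globalDivisibility_of_irreducible)
    (hmodP : nonempty_modularParametrizationData)
    (hR₂ : ∀ (W : WeierstrassCurve ℚ) [W.IsElliptic] [W.IsGloballyMinimal] [NeZero (W.conductorNorm ℤ)],
      ¬ W.HasCM →
      ∀ (K : Type) [Field K] [NumberField K], IsImaginaryQuadratic K →
      NumberField.discr K ≠ -3 → NumberField.discr K ≠ -4 →
      SatisfiesHeegnerHypothesis (W.conductorNorm ℤ) K → SatisfiesHeegnerHypothesis 2 K →
      ∀ (p : ℕ) [Fact p.Prime], p ≠ 2 → Addv W p → W.HasIrreducibleModPGaloisRep p →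
      ∀ (Dt : ModularParametrizationData W (W.conductorNorm ℤ)) (β : ℤ) (ι : K →+* ℂ)
        (d₁ : KolyvaginHeegnerData Dt β ι 1), ¬ IsOfFinAddOrder d₁.derivedPoint →
      ∀ (q : ℕ) [Fact q.Prime], q ∣ W.conductorNorm ℤ →
      ∀ (s : ℕ), s ≤ padicValNat p ((W.baseChange ℚ_[q]).localTamagawaNumber ℤ_[q]) →
        ∀ (n : ℕ) (d : KolyvaginHeegnerData Dt β ι n), Squarefree n →
          (∀ ℓ ∈ n.primeFactors, Zhang2014.IsKolyvaginPrime (W.conductorNorm ℤ) W K p ℓ ∧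
            s ≤ Zhang2014.kolyvaginIndex W p ℓ) →
          ∃ Q : (W.baseChange (ringClassField K ι n)).toAffine.Point,
            ((p ^ s : ℕ) : ℤ) • Q = d.derivedPoint)
    (W : WeierstrassCurve ℚ) [W.IsElliptic] [W.IsGloballyMinimal] [NeZero (W.conductorNorm ℤ)]
    (hCM : ¬ W.HasCM) (hadd : Addv W 3) (hsub : SubGss W 3) (hr : W.analyticRank = 0)
    (q : ℕ) [Fact q.Prime] (hqN : q ∣ W.conductorNorm ℤ)
    (hmono : padicValNat 3 W.tamagawaProduct ≤ padicValNat 3 ((W.baseChange ℚ_[q]).localTamagawaNumber ℤ_[q]))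
    (Dt : ModularParametrizationData W (W.conductorNorm ℤ)) (hc : ¬ (3 : ℤ) ∣ Dt.c)
    (hPL : ∃ (K : Type) (_ : Field K) (_ : NumberField K) (Wd : WeierstrassCurve ℚ) (_ : Wd.IsElliptic) (_ : Wd.IsGloballyMinimal),
      IsImaginaryQuadratic K ∧ Odd (NumberField.discr K) ∧ SatisfiesHeegnerHypothesis (W.conductorNorm ℤ) K ∧
      SatisfiesHeegnerHypothesis 2 K ∧ (W.quadraticTwist (NumberField.discr K : ℚ)).entireLFunction 1 = 0 ∧
      deriv (W.quadraticTwist (NumberField.discr K : ℚ)).entireLFunction 1 ≠ 0 ∧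
      (∃ C : VariableChange ℚ, C • W.quadraticTwist (NumberField.discr K : ℚ) = Wd) ∧ MissingLowerBoundAt Wd 3) :
    MissingUpperBoundAt W 3 :=
  leafRankZeroUpper_three_of_sigmaAtDatumTwoSplit_of_partnerLowerZeroTwoSplit hGZ hKo hGZK hmod hMN hmodP W hCM hadd hsub hr Dt hPL
    (fun K _ _ H ι P hK hHN h2K _ _ hP hnt hodd s' hs' n d hn hℓ ↦
      sigmaAtDatum_three_of_anyCarrierReading_monoCarrierAny hR₂ W hCM hadd hsub q hqN hmono Dt hc K H ι P hK hHN h2K hP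
        hnt hodd s' hs' n d hn hℓ)

/-! ## §2₀ At a lattice-optimal member: U₀ ⟸ print⁺ + three named facts + Σ★‴ + PL₁|₂(W) -/

/-- **U₀ AT A RANK-ZERO LEAF CURVE CARRYING A LATTICE-OPTIMAL DATUM ⟸ print⁺ + {F1, F2, F3} + Σ★‴ + PL₁|₂(W)** — p641367 §3 with the row predicate
widened to the mono-carrier rows of any reduction type (ON: §1₀ fed by `anyCarrierTwoSplitReading_of_namedFacts`; OFF: p641367 §1 with Σ★‴ at the
datum through `sigmaZeroOptOffMonoRows_of_sigmaStarOptOffMonoRows`). CONDITIONAL; nothing asserted. [cite: Jetchev2008, Conj. 1.3, Thm. 1.4 (p. 812)]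
[cite: GrossLMS1991, Prop. 3.7 (2)] [cite: MilneADT2006, Ch. I, Thm. 4.10(b)] [cite: Mazur1978, Cor. 4.1] [cite: Miller2011LMS, Def. 1.1] -/
theorem leafRankZeroUpper_three_of_latticeOptimal_of_namedFacts_of_sigmaStarMono_of_partnerLowerZeroTwoSplit
    (hGZ : ∀ (N : ℕ) [NeZero N] (W : WeierstrassCurve ℚ) (K : Type) [Field K] [NumberField K],
      gross_zagier N W K)
    (hKo : ∀ (N : ℕ) [NeZero N] (W : WeierstrassCurve ℚ) (K : Type) [Field K] [NumberField K],
      kolyvagin N W K)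
    (hGZK : rank_eq_analyticRank_of_analyticRank_le_one) (hmod : hasEntireLFunction_rat)
    (hMN : MatarNekovar2019.thm07_padicValNat_card_sha_primary_add_le_of_globalDivisibility_of_irreducible)
    (hnf : exists_isNewformOf) (hmodP : nonempty_modularParametrizationData)
    (hM : mazur_not_dvd_maninConstant_of_odd) (hAU : abbesUllmo_not_dvd_maninConstant_of_not_dvd_level)
    (hC2 : cesnavicius_not_two_dvd_maninConstant_of_two_dvd_level)
    (h37 : GrossLMS1991.prop37_2_frobeniusCongruence)
    (hPT : ∀ (K : Type) [Field K] [NumberField K],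
      Literature.NumberTheory.GaloisCohomology.poitouTate_selmerStructure_duality_conj K)
    (hF1 : Gross1991_heegnerPoint_sub_ratTorsion_mem_E0_imageFree)
    (hStar : ∀ (W : WeierstrassCurve ℚ) [W.IsElliptic] [W.IsGloballyMinimal] (N : ℕ) [NeZero N]
      (K : Type) [Field K] [NumberField K]
      (Dt : ModularParametrizationData W N) (H : HeegnerDatum N (NumberField.discr K)) (ι : K →+* ℂ)
      (P : (W.baseChange K).toAffine.Point),
      ¬ W.HasCM → Addv W 3 → SubGss W 3 → W.conductorNorm ℤ = N →
      (∀ z ∈ Dt.L.lattice, ∃ w ∈ periodLattice Dt.f, z = Dt.c * w) →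
      ¬ (∃ (q : ℕ) (_ : Fact q.Prime), q ∣ N ∧
          padicValNat 3 W.tamagawaProduct ≤ padicValNat 3 ((W.baseChange ℚ_[q]).localTamagawaNumber ℤ_[q])) →
      IsImaginaryQuadratic K → SatisfiesHeegnerHypothesis N K →
      (WeierstrassCurve.Affine.Point.map ι.toRatAlgHom) P = heegnerPointComplex Dt H →
      ¬ IsOfFinAddOrder P → Odd (NumberField.discr K) →
      ∀ (s' : ℕ), s' ≤ padicValNat 3 W.tamagawaProduct + padicValNat 3 Dt.c.natAbs →
      ∀ (n : ℕ) (d : KolyvaginHeegnerData Dt H.β ι n), Squarefree n →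
      (∀ ℓ ∈ n.primeFactors, Zhang2014.IsKolyvaginPrime N W K 3 ℓ ∧ s' ≤ Zhang2014.kolyvaginIndex W 3 ℓ) →
      Koly.PDiv d 3 s')
    (W : WeierstrassCurve ℚ) [W.IsElliptic] [W.IsGloballyMinimal] [NeZero (W.conductorNorm ℤ)]
    (hCM : ¬ W.HasCM) (hadd : Addv W 3) (hsub : SubGss W 3) (hr : W.analyticRank = 0)
    (Dt : ModularParametrizationData W (W.conductorNorm ℤ))
    (hopt : ∀ z ∈ Dt.L.lattice, ∃ w ∈ periodLattice Dt.f, z = Dt.c * w)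
    (hPL : ∃ (K : Type) (_ : Field K) (_ : NumberField K) (Wd : WeierstrassCurve ℚ) (_ : Wd.IsElliptic) (_ : Wd.IsGloballyMinimal),
      IsImaginaryQuadratic K ∧ Odd (NumberField.discr K) ∧ SatisfiesHeegnerHypothesis (W.conductorNorm ℤ) K ∧
      SatisfiesHeegnerHypothesis 2 K ∧ (W.quadraticTwist (NumberField.discr K : ℚ)).entireLFunction 1 = 0 ∧
      deriv (W.quadraticTwist (NumberField.discr K : ℚ)).entireLFunction 1 ≠ 0 ∧
      (∃ C : VariableChange ℚ, C • W.quadraticTwist (NumberField.discr K : ℚ) = Wd) ∧ MissingLowerBoundAt Wd 3) :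
    MissingUpperBoundAt W 3 := by
  by_cases hrow : ∃ (q : ℕ) (_ : Fact q.Prime), q ∣ W.conductorNorm ℤ ∧
      padicValNat 3 W.tamagawaProduct ≤ padicValNat 3 ((W.baseChange ℚ_[q]).localTamagawaNumber ℤ_[q])
  · obtain ⟨q, _, hqN, hmono⟩ := hrow
    exact leafRankZeroUpper_three_monoCarrierAny_of_anyCarrierReading_of_partnerLowerZeroTwoSplit hGZ hKo hGZK hmod hMN hmodP
      (JetchevReadingAnyCarrier.anyCarrierTwoSplitReading_of_namedFacts h37 hPT hF1) W hCM hadd hsub hr q hqN hmono Dt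
      (not_three_dvd_c_of_latticeOptimal_of_subGss hM hAU hC2 hnf W Dt hopt hadd hsub) hPL
  · exact leafRankZeroUpper_three_of_sigmaAtDatumTwoSplit_of_partnerLowerZeroTwoSplit hGZ hKo hGZK hmod hMN hmodP W hCM hadd hsub hr
      Dt hPL (fun K _ _ H ι P hK hHN _ hL0' hLd1 hP hnt hodd s' hs' n d hn hℓ ↦
        sigmaZeroOptOffMonoRows_of_sigmaStarOptOffMonoRows hStar W (W.conductorNorm ℤ) K Dt H ι P hCM hadd hsub hr rfl hopt hrow hK
          hHN hL0' hLd1 hP hnt hodd s' hs' n d hn hℓ)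

/-! ## §3₀ The class statement BY NAME: `LeafRankZeroUpperAtThree` ⟸ PUB₀⁺ ∧ three named facts ∧ Σ★‴ ∧ PL₁|₂ -/

/-- **`LeafRankZeroUpperAtThree` (26024) BY NAME ⟸ PUB₀⁺ ∧ {F1, F2, F3} ∧ Σ★‴ ∧ PL₁|₂** (every non-CM leaf curve of analytic rank `0` has a rank-one
Heegner partner over a field in which `2` splits, carrying its lower half; inline). NEITHER S2 NOR L₁ NOR L₀ is a hypothesis. p641367 §4 with
Σ★″ ↦ Σ★‴: optimal member, §2₀, Cassels back. CONDITIONAL; U₀ stays OPEN; BSD is not proved. [cite: Jetchev2008, Conj. 1.3, Thm. 1.4 (p. 812)]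
[cite: GrossLMS1991, Prop. 3.7 (2) (p. 240)] [cite: MilneADT2006, Ch. I, Thm. 4.10(b); Thm. I.7.3] [cite: MatarNekovar2019, Thm. 0.7 and Thm. 0.3 (p. 456)]
[cite: Mazur1978, Cor. 4.1] [cite: Miller2011LMS, Def. 1.1] -/
theorem leafRankZeroUpperAtThree_of_pubManin_of_namedFacts_of_sigmaStarMono_of_partnerLowerZeroTwoSplit
    (hpub : (∀ (N : ℕ) [NeZero N] (W : WeierstrassCurve ℚ) (K : Type) [Field K] [NumberField K],
        Literature.NumberTheory.EllipticCurves.gross_zagier N W K) ∧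
      (∀ (N : ℕ) [NeZero N] (W : WeierstrassCurve ℚ) (K : Type) [Field K] [NumberField K],
        Literature.NumberTheory.EllipticCurves.kolyvagin N W K) ∧
      Literature.NumberTheory.EllipticCurves.rank_eq_analyticRank_of_analyticRank_le_one ∧
      WeierstrassCurve.hasEntireLFunction_rat ∧
      Literature.NumberTheory.EllipticCurves.MatarNekovar2019.thm07_padicValNat_card_sha_primary_add_le_of_globalDivisibility_of_irreducible ∧
      Literature.NumberTheory.EllipticCurves.ModularForms.exists_isNewformOf ∧
      Literature.NumberTheory.EllipticCurves.bumpFriedbergHoffstein_exists_heegnerField_split_twist_simpleZero ∧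
      Literature.NumberTheory.EllipticCurves.ModularForms.nonempty_modularParametrizationData ∧
      WeierstrassCurve.bsdRHS_eq_of_isIsogenous ∧
      Literature.NumberTheory.EllipticCurves.ModularForms.mazur_not_dvd_maninConstant_of_odd ∧
      Literature.NumberTheory.EllipticCurves.ModularForms.abbesUllmo_not_dvd_maninConstant_of_not_dvd_level ∧
      Literature.NumberTheory.EllipticCurves.ModularForms.cesnavicius_not_two_dvd_maninConstant_of_two_dvd_level)
    (h37 : GrossLMS1991.prop37_2_frobeniusCongruence)
    (hPT : ∀ (K : Type) [Field K] [NumberField K],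
      Literature.NumberTheory.GaloisCohomology.poitouTate_selmerStructure_duality_conj K)
    (hF1 : Gross1991_heegnerPoint_sub_ratTorsion_mem_E0_imageFree)
    (hStar : ∀ (W : WeierstrassCurve ℚ) [W.IsElliptic] [W.IsGloballyMinimal] (N : ℕ) [NeZero N]
      (K : Type) [Field K] [NumberField K]
      (Dt : ModularParametrizationData W N) (H : HeegnerDatum N (NumberField.discr K)) (ι : K →+* ℂ)
      (P : (W.baseChange K).toAffine.Point),
      ¬ W.HasCM → Addv W 3 → SubGss W 3 → W.conductorNorm ℤ = N →
      (∀ z ∈ Dt.L.lattice, ∃ w ∈ periodLattice Dt.f, z = Dt.c * w) →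
      ¬ (∃ (q : ℕ) (_ : Fact q.Prime), q ∣ N ∧
          padicValNat 3 W.tamagawaProduct ≤ padicValNat 3 ((W.baseChange ℚ_[q]).localTamagawaNumber ℤ_[q])) →
      IsImaginaryQuadratic K → SatisfiesHeegnerHypothesis N K →
      (WeierstrassCurve.Affine.Point.map ι.toRatAlgHom) P = heegnerPointComplex Dt H →
      ¬ IsOfFinAddOrder P → Odd (NumberField.discr K) →
      ∀ (s' : ℕ), s' ≤ padicValNat 3 W.tamagawaProduct + padicValNat 3 Dt.c.natAbs →
      ∀ (n : ℕ) (d : KolyvaginHeegnerData Dt H.β ι n), Squarefree n →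
      (∀ ℓ ∈ n.primeFactors, Zhang2014.IsKolyvaginPrime N W K 3 ℓ ∧ s' ≤ Zhang2014.kolyvaginIndex W 3 ℓ) →
      Koly.PDiv d 3 s')
    (hPL : ∀ (W : WeierstrassCurve ℚ) [W.IsElliptic] [W.IsGloballyMinimal], ¬ W.HasCM →
      Literature.NumberTheory.EllipticCurves.Rank1Residual.Addv W 3 →
      Summit.BirchSwinnertonDyer.Rank1Residual.Additive.SubGss W 3 → W.analyticRank = 0 →
      ∃ (K : Type) (_ : Field K) (_ : NumberField K) (Wd : WeierstrassCurve ℚ) (_ : Wd.IsElliptic) (_ : Wd.IsGloballyMinimal),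
        IsImaginaryQuadratic K ∧ Odd (NumberField.discr K) ∧ SatisfiesHeegnerHypothesis (W.conductorNorm ℤ) K ∧
        SatisfiesHeegnerHypothesis 2 K ∧ (W.quadraticTwist (NumberField.discr K : ℚ)).entireLFunction 1 = 0 ∧
        deriv (W.quadraticTwist (NumberField.discr K : ℚ)).entireLFunction 1 ≠ 0 ∧
        (∃ C : VariableChange ℚ, C • W.quadraticTwist (NumberField.discr K : ℚ) = Wd) ∧ MissingLowerBoundAt Wd 3) :
    LeafRankZeroUpperAtThree := by
  intro W _ _ hCM hadd hsub hr
  obtain ⟨hGZ, hKo, hGZK, hmod, hMN, hnf, -, hmodP, hCassels, hM, hAU, hC2⟩ := hpub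
  obtain ⟨W₀, hW₀, hW₀', N, hN0, D₀, hiso, hN₀, -, hopt, hCM₀, hadd₀, hsub₀, hr₀⟩ :=
    exists_optimal_leaf_member hnf W hCM hadd hsub
  haveI := hW₀
  haveI := hW₀'
  haveI := hN0
  have hr₀' : W₀.analyticRank = 0 := hr₀.trans hr
  have h₀ : MissingUpperBoundAt W₀ 3 := by
    subst hN₀
    exact leafRankZeroUpper_three_of_latticeOptimal_of_namedFacts_of_sigmaStarMono_of_partnerLowerZeroTwoSplit hGZ hKo hGZK hmod hMN
      hnf hmodP hM hAU hC2 h37 hPT hF1 hStar W₀ hCM₀ hadd₀ hsub₀ hr₀' D₀ hopt (hPL W₀ hCM₀ hadd₀ hsub₀ hr₀')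
  exact missingUpperBoundAt_of_isIsogenous_of_analyticRank_le_one hCassels hGZK hmod (by rw [hr]; exact zero_le_one) hiso h₀

/-! ## §4₀ Per curve: U₀ on a mono-carrier row of ANY reduction type from PRINT + three named facts + TU₀|₂(W) — the certificate shape -/

/-- **U₀ AT ONE CURVE on a mono-carrier row of ANY reduction type from PRINT + THREE NAMED FACTS + ONE rank-zero twist-unit certificate (field
splitting `2`).** For `W/ℚ` globally minimal, non-CM, leaf Gss2 at `3`, `r_an(W) = 0`; a prime `q ∣ N_E` (multiplicative OR additive) with
`ord₃ ∏_ℓ c_ℓ(E) ≤ ord₃ c_q(E)`; a parametrisation datum at level `N_E` with `3 ∤ c`; and TU₀|₂(W) (a Heegner field with `2` split and odd `d_K`, a SIMPLE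
zero of `L(W^{(d_K)}, s)` at `1`, a member `W₂ ∼ W` whose twist has `#Ш_an` of non-positive `3`-adic valuation): `Typed.MissingUpperBoundAt W 3`
follows from the printed named facts (Gross–Zagier ∀, Kolyvagin ∀, GZK, Version L, Matar–Nekovář 2019 Thm. 0.7, a parametrisation datum, Cassels)
and {F1, F2, F3}. NO S2, NO L₁, NO L₀, NO Σ, NO `q ∥ N`. = §1₀ ∘ {`anyCarrierTwoSplitReading_of_namedFacts`, p641367 §5
`partnerLowerZeroTwoSplit_of_twistUnitZeroTwoSplit`}. Certificate shape for the single-carrier rank-zero Gss2 classes of ANY carrier type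
(233 = 190 multiplicative + 43 additive). CONDITIONAL on the displayed facts and data; nothing asserted about any curve; BSD is not proved.
[cite: Jetchev2008, Thm. 1.4 and Cor. 1.5 (p. 812)] [cite: GrossLMS1991, Prop. 3.7 (2) (p. 240)] [cite: MilneADT2006, Ch. I, Thm. 4.10(b); Thm. I.7.3]
[cite: GrossZagier1986, III (3.1); Thm. I.(6.3)] [cite: MatarNekovar2019, Thm. 0.7 (p. 456)] [cite: Miller2011LMS, Def. 1.1] -/
theorem leafRankZeroUpper_three_monoCarrierAny_of_namedFacts_of_twistUnitZeroTwoSplit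
    (hGZ : ∀ (N : ℕ) [NeZero N] (W : WeierstrassCurve ℚ) (K : Type) [Field K] [NumberField K],
      gross_zagier N W K)
    (hKo : ∀ (N : ℕ) [NeZero N] (W : WeierstrassCurve ℚ) (K : Type) [Field K] [NumberField K],
      kolyvagin N W K)
    (hGZK : rank_eq_analyticRank_of_analyticRank_le_one) (hmod : hasEntireLFunction_rat)
    (hMN : MatarNekovar2019.thm07_padicValNat_card_sha_primary_add_le_of_globalDivisibility_of_irreducible)
    (hmodP : nonempty_modularParametrizationData) (hCassels : bsdRHS_eq_of_isIsogenous)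
    (h37 : GrossLMS1991.prop37_2_frobeniusCongruence)
    (hPT : ∀ (K : Type) [Field K] [NumberField K],
      Literature.NumberTheory.GaloisCohomology.poitouTate_selmerStructure_duality_conj K)
    (hF1 : Gross1991_heegnerPoint_sub_ratTorsion_mem_E0_imageFree)
    (W : WeierstrassCurve ℚ) [W.IsElliptic] [W.IsGloballyMinimal] [NeZero (W.conductorNorm ℤ)]
    (hCM : ¬ W.HasCM) (hadd : Addv W 3) (hsub : SubGss W 3) (hr : W.analyticRank = 0)
    (q : ℕ) [Fact q.Prime] (hqN : q ∣ W.conductorNorm ℤ)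
    (hmono : padicValNat 3 W.tamagawaProduct ≤ padicValNat 3 ((W.baseChange ℚ_[q]).localTamagawaNumber ℤ_[q]))
    (Dt : ModularParametrizationData W (W.conductorNorm ℤ)) (hc : ¬ (3 : ℤ) ∣ Dt.c)
    (hTU : ∃ (K : Type) (_ : Field K) (_ : NumberField K) (W₂ W₂d : WeierstrassCurve ℚ) (_ : W₂.IsElliptic)
      (_ : W₂.IsGloballyMinimal) (_ : W₂d.IsElliptic) (_ : W₂d.IsGloballyMinimal),
      IsImaginaryQuadratic K ∧ Odd (NumberField.discr K) ∧ SatisfiesHeegnerHypothesis (W.conductorNorm ℤ) K ∧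
      SatisfiesHeegnerHypothesis 2 K ∧ (W.quadraticTwist (NumberField.discr K : ℚ)).entireLFunction 1 = 0 ∧
      deriv (W.quadraticTwist (NumberField.discr K : ℚ)).entireLFunction 1 ≠ 0 ∧
      IsIsogenous W W₂ ∧ (∃ C : VariableChange ℚ, C • W₂.quadraticTwist (NumberField.discr K : ℚ) = W₂d) ∧
      ∃ qd : ℚ, shaAn W₂d = (qd : ℂ) ∧ padicValRat 3 qd ≤ 0) :
    MissingUpperBoundAt W 3 :=
  leafRankZeroUpper_three_monoCarrierAny_of_anyCarrierReading_of_partnerLowerZeroTwoSplit hGZ hKo hGZK hmod hMN hmodP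
    (JetchevReadingAnyCarrier.anyCarrierTwoSplitReading_of_namedFacts h37 hPT hF1) W hCM hadd hsub hr q hqN hmono Dt hc
    (partnerLowerZeroTwoSplit_of_twistUnitZeroTwoSplit hCassels hGZK hmod W hTU)

end Summit.BirchSwinnertonDyer.BirchSwinnertonDyer.Theorems.RamifiedPairUpperBound

end
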